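import Mathlib.MeasureTheory.Integral.MeanInequalities
import Mathlib.MeasureTheory.Integral.Lebesgue.Map
import Mathlib.Dynamics.Ergodic.MeasurePreserving
import Mathlib.Analysis.SpecialFunctions.Pow.NNReal
import HarnessLib

/-!
# Exponential moments of Cesàro averages under an invariant law (helper, layer 1)

Crux `Summit.AtomisticToContinuum.HydrodynamicLimit.Theses.AntiMazurCoboundaries.KineticWindowGronwall`
(stmt-AtomisticToContinuum-9282), line `dlr-block-transfer` v4, helper toward the lead's stub `stub_blockTransfer`
(step "common window by `Λ_{mτ} ≤ Λ_τ` under the INVARIANT homogeneous law"), also the step "`τ Λ_τ` is subadditive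
by Hölder + invariance" of the shared crux stmt-10967 `KineticFluxLdDecay`.

Pure measure theory. For a measure-preserving self-map `T` of `(α, P)`, a measurable `Y : α → ℝ` and `m ≥ 1`,
`∫⁻ exp (m⁻¹ Σ_{k<m} Y ∘ T^k) dP ≤ ∫⁻ exp Y dP`: write `exp (m⁻¹ Σ_k Y_k) = Π_k (exp Y_k)^{1/m}`, apply the
finite-family Hölder inequality `ENNReal.lintegral_prod_norm_pow_le` with the `m` equal exponents `1/m`, and use
invariance `∫⁻ exp (Y ∘ T^k) dP = ∫⁻ exp Y dP` (`MeasurePreserving.iterate`, `MeasurePreserving.lintegral_comp`).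
Registered helper stub `stub_cesaroExpMoment : CesaroExpMomentSubadditivity`; corollary with an exponent weight
`β` (`lintegral_exp_smul_cesaro_le`).
-/

noncomputable section

open scoped BigOperators ENNReal
open MeasureTheory Finset Function

namespace Summit.AtomisticToContinuum.HydrodynamicLimit.Theorems.KineticWindowGronwallWindowSubadditivity

/-- **CESÀRO EXPONENTIAL-MOMENT SUBADDITIVITY** (Hölder + invariance). For a measurable space `α`, a measure `P`,
a map `T : α → α` preserving `P`, a measurable `Y : α → ℝ` and `0 < m`:
`∫⁻ exp (m⁻¹ Σ_{k<m} Y (T^[k] z)) dP ≤ ∫⁻ exp (Y z) dP` (extended nonnegative integrals of `ENNReal.ofReal ∘ exp`).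
Folklore (Jensen/Hölder step behind subadditivity of `τ ↦ τ Λ_τ` for window log-moment generating functions). -/
def CesaroExpMomentSubadditivity : Prop :=
  ∀ {α : Type*} [MeasurableSpace α] (P : Measure α) (T : α → α), MeasurePreserving T P P →
    ∀ (Y : α → ℝ), Measurable Y → ∀ (m : ℕ), 0 < m →
    ∫⁻ z, ENNReal.ofReal (Real.exp ((m : ℝ)⁻¹ * ∑ k ∈ Finset.range m, Y (T^[k] z))) ∂P ≤
      ∫⁻ z, ENNReal.ofReal (Real.exp (Y z)) ∂P

/-- Pointwise identity in `ℝ≥0∞`: for `0 ≤ c`, `exp (c Σ_{k∈s} a_k) = Π_{k∈s} (exp a_k)^c` (used with `c = 1/m`).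
[folklore] -/
theorem ofReal_exp_inv_mul_sum {ι : Type*} (s : Finset ι) (a : ι → ℝ) (c : ℝ) (hc : 0 ≤ c) :
    ENNReal.ofReal (Real.exp (c * ∑ k ∈ s, a k)) =
      ∏ k ∈ s, ENNReal.ofReal (Real.exp (a k)) ^ c := by
  rw [Finset.mul_sum, Real.exp_sum, ENNReal.ofReal_prod_of_nonneg fun i _ => (Real.exp_pos _).le]
  refine Finset.prod_congr rfl fun k _ => ?_
  rw [mul_comm, Real.exp_mul, ENNReal.ofReal_rpow_of_nonneg (Real.exp_pos _).le hc]

/-- Invariance of exponential moments along the iterates of a measure-preserving map: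
`∫⁻ exp (Y ∘ T^[k]) dP = ∫⁻ exp Y dP`. [folklore] -/
theorem lintegral_ofReal_exp_comp_iterate {α : Type*} [MeasurableSpace α] {P : Measure α} {T : α → α}
    (hT : MeasurePreserving T P P) {Y : α → ℝ} (hY : Measurable Y) (k : ℕ) :
    ∫⁻ z, ENNReal.ofReal (Real.exp (Y (T^[k] z))) ∂P = ∫⁻ z, ENNReal.ofReal (Real.exp (Y z)) ∂P :=
  (hT.iterate k).lintegral_comp (f := fun z => ENNReal.ofReal (Real.exp (Y z)))
    (hY.exp.ennreal_ofReal)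

/-- **Layer 1 in applied form** (all hypotheses explicit): for `T` preserving `P`, `Y` measurable and `0 < m`,
`∫⁻ exp (m⁻¹ Σ_{k<m} Y (T^[k] z)) dP ≤ ∫⁻ exp (Y z) dP` — Hölder with `m` equal exponents `1/m`
(`ENNReal.lintegral_prod_norm_pow_le`) and invariance (`lintegral_ofReal_exp_comp_iterate`). [folklore] -/
theorem lintegral_exp_cesaro_le {α : Type*} [MeasurableSpace α] (P : Measure α) (T : α → α)
    (hT : MeasurePreserving T P P) (Y : α → ℝ) (hY : Measurable Y) (m : ℕ) (hm : 0 < m) :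
    ∫⁻ z, ENNReal.ofReal (Real.exp ((m : ℝ)⁻¹ * ∑ k ∈ Finset.range m, Y (T^[k] z))) ∂P ≤
      ∫⁻ z, ENNReal.ofReal (Real.exp (Y z)) ∂P := by
  have hm0 : (m : ℝ) ≠ 0 := Nat.cast_ne_zero.mpr hm.ne'
  have hc : 0 ≤ (m : ℝ)⁻¹ := inv_nonneg.mpr (Nat.cast_nonneg m)
  have hmeas : ∀ k ∈ Finset.range m,
      AEMeasurable (fun z => ENNReal.ofReal (Real.exp (Y (T^[k] z)))) P := fun k _ =>
    ((hY.comp (hT.measurable.iterate k)).exp.ennreal_ofReal).aemeasurable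
  have hsum : ∑ _k ∈ Finset.range m, (m : ℝ)⁻¹ = 1 := by
    rw [Finset.sum_const, Finset.card_range, nsmul_eq_mul, mul_inv_cancel₀ hm0]
  calc ∫⁻ z, ENNReal.ofReal (Real.exp ((m : ℝ)⁻¹ * ∑ k ∈ Finset.range m, Y (T^[k] z))) ∂P
      = ∫⁻ z, ∏ k ∈ Finset.range m, ENNReal.ofReal (Real.exp (Y (T^[k] z))) ^ (m : ℝ)⁻¹ ∂P := by
        refine lintegral_congr fun z => ?_
        exact ofReal_exp_inv_mul_sum (Finset.range m) (fun k => Y (T^[k] z)) _ hc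
    _ ≤ ∏ k ∈ Finset.range m, (∫⁻ z, ENNReal.ofReal (Real.exp (Y (T^[k] z))) ∂P) ^ (m : ℝ)⁻¹ :=
        ENNReal.lintegral_prod_norm_pow_le (Finset.range m) hmeas hsum fun _ _ => hc
    _ = ∏ _k ∈ Finset.range m, (∫⁻ z, ENNReal.ofReal (Real.exp (Y z)) ∂P) ^ (m : ℝ)⁻¹ := by
        refine Finset.prod_congr rfl fun k _ => ?_
        rw [lintegral_ofReal_exp_comp_iterate hT hY k]
    _ = ∫⁻ z, ENNReal.ofReal (Real.exp (Y z)) ∂P := by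
        rw [Finset.prod_const, Finset.card_range, ENNReal.rpow_inv_natCast_pow hm.ne']

/-- **Corollary (general exponent weight).** Under the same hypotheses, for every real `β`:
`∫⁻ exp (β · m⁻¹ Σ_{k<m} Y (T^[k] z)) dP ≤ ∫⁻ exp (β · Y z) dP` (layer 1 applied to `β • Y`). [folklore] -/
theorem lintegral_exp_smul_cesaro_le {α : Type*} [MeasurableSpace α] (P : Measure α) (T : α → α)
    (hT : MeasurePreserving T P P) (Y : α → ℝ) (hY : Measurable Y) (m : ℕ) (hm : 0 < m) (β : ℝ) :
    ∫⁻ z, ENNReal.ofReal (Real.exp (β * ((m : ℝ)⁻¹ * ∑ k ∈ Finset.range m, Y (T^[k] z)))) ∂P ≤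
      ∫⁻ z, ENNReal.ofReal (Real.exp (β * Y z)) ∂P := by
  have h := lintegral_exp_cesaro_le P T hT (fun z => β * Y z) (hY.const_mul β) m hm
  refine le_of_eq_of_le (lintegral_congr fun z => ?_) h
  simp only [Finset.mul_sum]
  congr 2
  exact Finset.sum_congr rfl fun k _ => by ring

/-- **Layer 1, proved**: the Cesàro exponential-moment subadditivity `stub_cesaroExpMoment` (the weighted corollary
at `β = 1`). [folklore] -/
theorem stub_cesaroExpMoment : CesaroExpMomentSubadditivity := by
  intro α _ P T hT Y hY m hm
  simpa only [one_mul] using lintegral_exp_smul_cesaro_le P T hT Y hY m hm 1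

end Summit.AtomisticToContinuum.HydrodynamicLimit.Theorems.KineticWindowGronwallWindowSubadditivity

end
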